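import Literature.NumberTheory.EllipticCurves.QuadraticTwistProofs
import Literature.NumberTheory.EllipticCurves.QuadraticTwistRank
import Literature.NumberTheory.EllipticCurves.FrobeniusEndomorphism
import Literature.NumberTheory.EllipticCurves.SelmerCorankProofs
import Literature.NumberTheory.EllipticCurves.BSDInvariantsProofs
import Literature.NumberTheory.EllipticCurves.GaloisActionProofs
import Literature.NumberTheory.EllipticCurves.HeegnerPointsKolyvaginPrimaryRamifiedProofs
import HarnessLib

/-!
# Frobenius eigenspaces of `Ẽ(k̄)` over a finite field: the counts `#{Frob = ±1}` and the eigenlines of `Ẽ[p]`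

Cell `b2b-bsdres`, team x11b3 (N8/O2), sub-target S15 (viii) (lead ruling R7-62): the finite-field
half of the **reduction datum** `hdata` of the tree's McCallum Prop. 4.4 / Gross Prop. 6.2 (2) theorem
`Literature.NumberTheory.EllipticCurves.zsmul_kolyvaginClass_mem_selmerLocalKer_iff_of_isKolyvaginPrime`
(`HeegnerPointsKolyvaginPrimaryRamifiedProofs`, §5). HONEST FRAMING (cell, verbatim): published
theorems only; nothing here is `p = 3`-specific; Kolyvagin-chain hygiene, not a discharge of `h44`
(Gross Prop. 3.7 and the ring-class decomposition stay hypotheses downstream); nothing booked.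
Theorems only — no definition, no named fact.

For an elliptic curve `E` over a finite field `k` with `q` elements, `σ = Frob_q ∈ Γ_k`
(`σ x = x^q` on `k̄`), acting on `Ẽ(k̄) = geomPoints E`:

* `natCard_smul_eq_self` — `#{P : σP = P} = #E(k)` (Silverman AEC V.1.1, tree
  `smul_eq_self_iff_mem_range_toGeomPoints`).
* `natCard_smul_eq_neg`, `natCard_smul_eq_neg_eq` — for `k` of odd characteristic,
  `#{P : σP = -P} = #E^{(c)}(k) = q + 1 + a` (`c` a non-square, `a = q + 1 - #E(k)`): the anti-fixed
  points of the completed-square model are the image of the tree's twisting map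
  `QuadraticDescent.twistMap` (Silverman AEC X.2 / Exercise 10.16), counted by Knapp's twisting
  formula (tree `card_add_one_sub_natCard_point_quadraticTwist`, Prop. 12.10). This is Gross 1991,
  (3.4): *"`Ẽ(F_λ)^+` has order `ℓ+1-a_ℓ`, and `Ẽ(F_λ)^-` has order `ℓ+1+a_ℓ`"*.
* `natCard_torsion_eigen` — if `σ` acts on `Ẽ[p] ≅ (ℤ/p)²` (`p` odd, invertible in `k`) as a
  NON-SCALAR INVOLUTION, both eigenlines `Ẽ[p]^{σ = ±1}` have exactly `p` elements (Gross (3.4)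
  *"`Ẽ(F_λ)_p^± ≃ ℤ/pℤ`"*; McCallum 1991 §3), via `#Ẽ[p] = p²` (tree `card_torsionPoints_eq_sq_holds`)
  and the odd-`p` eigen-decomposition (tree `KolyvaginChi.exists_eigen_add_eigen`).

## References
* [GrossLMS1991] B. H. Gross, *Kolyvagin's work on modular elliptic curves*, LMS LNS 153 (1991),
  §3 (3.2)–(3.4) (held `book:editornd-l-functions-arithmetic`, PDF p. 216).
* [McCallumLMS1991] W. G. McCallum, *Kolyvagin's work on Shafarevich–Tate groups*, ibid., §3 and
  Prop. 4.4 (proof) (PDF pp. 282–283).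
* [SilvermanAEC2009] J. H. Silverman, *The Arithmetic of Elliptic Curves*, 2nd ed., V.1.1, X.2,
  Exercise 10.16, III.6.4(b).
* [Knapp1993] A. W. Knapp, *Elliptic Curves*, Prop. 12.10.
-/

noncomputable section

open scoped Classical
open WeierstrassCurve Field
open Literature.NumberTheory.EllipticCurves

namespace Summit.BirchSwinnertonDyer.Rank1Residual.X11b.KolyvaginH44

section FixedPoints

variable {k : Type*} [Field k] [Finite k] (E : WeierstrassCurve k)
  {σ : absoluteGaloisGroup k} (hσ : ∀ x : AlgebraicClosure k, σ • x = x ^ Nat.card k)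

include hσ in
/-- **`#{P ∈ Ẽ(k̄) : Frob P = P} = #Ẽ(k)`**: the Frobenius-fixed geometric points are the
`k`-rational points (tree `smul_eq_self_iff_mem_range_toGeomPoints`, Silverman AEC V.1.1).
[cite: SilvermanAEC2009, proof of Thm. V.1.1] -/
theorem natCard_smul_eq_self :
    Nat.card {P : geomPoints E // σ • P = P} = Nat.card E.toAffine.Point := by
  have e1 : {P : geomPoints E // σ • P = P} ≃ Set.range (toGeomPoints E) :=
    Equiv.subtypeEquivRight fun P ↦ smul_eq_self_iff_mem_range_toGeomPoints (W := E) hσ P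
  rw [Nat.card_congr e1, Nat.card_range_of_injective (toGeomPoints_injective E)]


omit [Finite k] in
/-- Transport of the anti-fixed count along an equality of curves. [folklore] -/
theorem natCard_smul_eq_neg_congr {V V' : WeierstrassCurve k} (h : V = V') :
    Nat.card {Q : geomPoints V // σ • Q = -Q} = Nat.card {Q : geomPoints V' // σ • Q = -Q} := by
  subst h; rfl

omit [Finite k] in
/-- Transport of the anti-fixed count along a `k`-rational change of variables (the induced
isomorphism `Ẽ(k̄) ≃ Ẽ'(k̄)` is `Γ_k`-equivariant, tree `geomPointsEquiv_smul`). [folklore] -/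
theorem natCard_smul_eq_neg_variableChange (C : VariableChange k) :
    Nat.card {Q : geomPoints E // σ • Q = -Q} = Nat.card {Q : geomPoints (C • E) // σ • Q = -Q} := by
  refine Nat.card_congr ((geomPointsEquiv E C).toEquiv.subtypeEquiv fun P ↦ ?_)
  show σ • P = -P ↔ σ • geomPointsEquiv E C P = -(geomPointsEquiv E C P)
  rw [← geomPointsEquiv_smul, ← map_neg, (geomPointsEquiv E C).injective.eq_iff]

end FixedPoints

section AntiFixed

variable {k : Type*} [Field k] [Finite k] [NeZero (2 : k)] (E : WeierstrassCurve k)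
  {σ : absoluteGaloisGroup k} (hσ : ∀ x : AlgebraicClosure k, σ • x = x ^ Nat.card k)

omit [NeZero (2 : k)] in
include hσ in
/-- An element of `k̄` fixed by the arithmetic Frobenius lies in `k`. [folklore] -/
theorem exists_algebraMap_eq_of_smul_eq {x : AlgebraicClosure k} (hx : σ • x = x) :
    ∃ a : k, algebraMap k (AlgebraicClosure k) a = x :=
  mem_range_algebraMap_of_pow_card_eq ((hσ x).symm.trans hx)

include hσ in
/-- **A square root `θ ∈ k̄` of a non-square `c ∈ k` is moved to `-θ` by Frobenius** (Euler's
criterion `c^{(q-1)/2} = χ(c) = -1`, Mathlib `quadraticChar_eq_pow_of_char_ne_two'`). [folklore] -/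
theorem smul_eq_neg_of_sq_eq {c : k} (hc : ¬ IsSquare c) {θ : AlgebraicClosure k}
    (hθ : θ ^ 2 = algebraMap k (AlgebraicClosure k) c) : σ • θ = -θ := by
  haveI : Fintype k := Fintype.ofFinite k
  have h2 : ringChar k ≠ 2 := by
    intro h
    have : (2 : k) = 0 := by
      have := ringChar.spec k 2
      rw [h] at this
      exact_mod_cast this.mpr (dvd_refl 2)
    exact two_ne_zero this
  have hχ : (quadraticChar k c : k) = -1 := by
    rw [quadraticChar_neg_one_iff_not_isSquare.mpr hc]; push_cast; ring
  have hpow : c ^ (Fintype.card k / 2) = -1 := by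
    rw [← quadraticChar_eq_pow_of_char_ne_two' h2 c, hχ]
  have hodd : Fintype.card k % 2 = 1 := FiniteField.odd_card_of_char_ne_two h2
  have hq : Nat.card k = 2 * (Fintype.card k / 2) + 1 := by
    rw [Nat.card_eq_fintype_card]; omega
  rw [hσ θ, hq, pow_succ, pow_mul, hθ, ← map_pow, hpow, map_neg, map_one, neg_one_mul]

include hσ in
/-- **`#{P ∈ Ẽ(k̄) : Frob P = -P} = #Ẽ^{(c)}(k)`** for a non-square `c ∈ k` (`k` finite of odd
characteristic): on the completed-square model `y² = f(x)` the anti-fixed points are `(a, bθ)`,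
`a, b ∈ k`, `θ = √c`, i.e. the image of the twisting map `τ : Ẽ^{(c)}(k) → Ẽ(k̄)` (tree
`QuadraticDescent.twistMap`, `conjMap_twistMap`, `exists_twistMap_eq`; Silverman AEC X.2 /
Exercise 10.16). [cite: SilvermanAEC2009, Exercise 10.16] -/
theorem natCard_smul_eq_neg {c : k} (hc : ¬ IsSquare c) :
    Nat.card {P : geomPoints E // σ • P = -P} = Nat.card (E.quadraticTwist c).toAffine.Point := by
  classical
  set K := AlgebraicClosure k with hK
  -- a square root of `c` in `k̄`, not in `k`, negated by Frobenius
  obtain ⟨θ, hθ⟩ := IsAlgClosed.exists_pow_nat_eq (algebraMap k K c) two_pos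
  have hθk : θ ∉ Set.range (algebraMap k K) := by
    rintro ⟨t, rfl⟩
    rw [← map_pow] at hθ
    exact hc ⟨t, by rw [← sq]; exact ((algebraMap k K).injective hθ).symm⟩
  have hσθ : σ • θ = -θ := smul_eq_neg_of_sq_eq hσ hc hθ
  have hθ0 : θ ≠ 0 := Literature.NumberTheory.QuadraticFields.Quadratic.ne_zero_of_not_mem_range hθk
  -- pass to the completed-square model `V = E^{(1)}`
  obtain ⟨C, hC⟩ := E.exists_variableChange_quadraticTwist_one
  rw [natCard_smul_eq_neg_variableChange E C, natCard_smul_eq_neg_congr (σ := σ) hC]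
  -- the anti-fixed points of `V(k̄)` are the image of `τ`
  set σ' : K →ₐ[k] K := ((show K ≃ₐ[k] K from σ) : K →ₐ[k] K) with hσ'
  have hσ'θ : σ' θ = -θ := hσθ
  have hsmul : ∀ Q : geomPoints (E.quadraticTwist 1),
      σ • Q = QuadraticDescent.conjMap (E.quadraticTwist 1) σ' Q := fun Q ↦ rfl
  have hrange : ∀ Q : geomPoints (E.quadraticTwist 1),
      σ • Q = -Q ↔ Q ∈ Set.range (QuadraticDescent.twistMap E hθk hθ) := by
    intro Q
    constructor
    · intro hQ
      change ((E.quadraticTwist 1).baseChange K).toAffine.Point at Q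
      rcases Q with _ | ⟨x, y, h⟩
      · exact ⟨0, by rw [map_zero]; rfl⟩
      · have hQ' : QuadraticDescent.conjMap (E.quadraticTwist 1) σ' (.some x y h) =
            -(.some x y h) := hQ
        rw [Affine.Point.map_some, Affine.Point.neg_some, Affine.Point.some.injEq,
          QuadraticDescent.negY_quadraticTwist_one_baseChange] at hQ'
        obtain ⟨hx, hy⟩ := hQ'
        obtain ⟨a, ha⟩ := exists_algebraMap_eq_of_smul_eq hσ (x := x) hx
        have hyθ : σ • (y / θ) = y / θ := by
          rw [smul_div₀', show σ • y = σ' y from rfl, hy, hσθ, neg_div_neg_eq]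
        obtain ⟨b, hb⟩ := exists_algebraMap_eq_of_smul_eq hσ hyθ
        have hb' : algebraMap k K b * θ = y := by rw [hb, div_mul_cancel₀ y hθ0]
        obtain ⟨R, hR⟩ := QuadraticDescent.exists_twistMap_eq E hθk hθ h ha hb'
        exact ⟨R, hR⟩
    · rintro ⟨R, rfl⟩
      rw [hsmul]
      exact QuadraticDescent.conjMap_twistMap E hθk hθ hσ'θ R
  have e1 : {Q : geomPoints (E.quadraticTwist 1) // σ • Q = -Q} ≃
      Set.range (QuadraticDescent.twistMap E hθk hθ) :=
    Equiv.subtypeEquivRight hrange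
  rw [Nat.card_congr e1,
    Nat.card_range_of_injective (QuadraticDescent.twistMap_injective E hθk hθ)]

include hσ in
/-- **The minus count `#{Frob = -1} = q + 1 + a`** (`a = q + 1 - #Ẽ(k)`): by the twisting formula
`q + 1 - #Ẽ^{(c)}(k) = χ(c)(q + 1 - #Ẽ(k))` (Knapp, Prop. 12.10; tree
`card_add_one_sub_natCard_point_quadraticTwist`) with `χ(c) = -1`. Gross 1991 (3.4):
*"`Ẽ(F_λ)^-` has order `ℓ + 1 + a_ℓ`"*. [cite: Knapp1993, Prop. 12.10] [cite: GrossLMS1991, §3 (3.4)] -/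
theorem natCard_smul_eq_neg_eq [E.IsElliptic] :
    (Nat.card {P : geomPoints E // σ • P = -P} : ℤ) =
      (Nat.card k : ℤ) + 1 + ((Nat.card k : ℤ) + 1 - Nat.card E.toAffine.Point) := by
  haveI : Fintype k := Fintype.ofFinite k
  have h2 : ringChar k ≠ 2 := by
    intro h
    have : (2 : k) = 0 := by
      have := ringChar.spec k 2
      rw [h] at this
      exact_mod_cast this.mpr (dvd_refl 2)
    exact two_ne_zero this
  obtain ⟨c, hc⟩ := FiniteField.exists_nonsquare h2
  have hc0 : c ≠ 0 := by rintro rfl; exact hc (IsSquare.zero)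
  have htw := card_add_one_sub_natCard_point_quadraticTwist E hc0
  rw [quadraticChar_neg_one_iff_not_isSquare.mpr hc, ← Nat.card_eq_fintype_card] at htw
  rw [natCard_smul_eq_neg E hσ hc]
  linarith

end AntiFixed

/-! ## Eigenlines of an involution on `Ẽ[p]` (Gross 1991, (3.4): `Ẽ(F_λ)_p^± ≃ ℤ/p`) -/

section Eigenlines

variable {k : Type*} [Field k] (E : WeierstrassCurve k) [E.IsElliptic] {σ : absoluteGaloisGroup k}
  {p : ℕ} [hp : Fact p.Prime]

omit hp in
/-- `#Ẽ(k̄)[p] = p²` for `p` invertible in `k` (tree `card_torsionPoints_eq_sq_holds`,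
Silverman AEC III.6.4(b)). [cite: SilvermanAEC2009, Cor. III.6.4(b)] -/
theorem natCard_torsion_eq_sq (hpk : (p : k) ≠ 0) :
    Nat.card {P : geomPoints E // (p : ℤ) • P = 0} = p ^ 2 := by
  have hpK : ((p : ℕ) : AlgebraicClosure k) ≠ 0 := by
    rw [ne_eq, ← map_natCast (algebraMap k (AlgebraicClosure k)), map_eq_zero]; exact hpk
  rw [← card_torsionPoints_eq_sq_holds E (AlgebraicClosure k) hpK]
  refine Nat.card_congr (Equiv.subtypeEquivRight fun P ↦ ?_)
  rw [torsionPoints, AddSubgroup.torsionBy, Submodule.mem_toAddSubgroup, Submodule.mem_torsionBy_iff]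
  rfl

/-- `Ẽ(k̄)[p]` is finite (`p` invertible in `k`). [folklore] -/
theorem finite_torsion (hpk : (p : k) ≠ 0) : Finite {P : geomPoints E // (p : ℤ) • P = 0} := by
  apply Nat.finite_of_card_ne_zero
  rw [natCard_torsion_eq_sq E hpk]
  exact pow_ne_zero 2 hp.out.ne_zero

/-- The `s`-eigenspace of `σ` in `Ẽ(k̄)[p]` is finite. [folklore] -/
theorem finite_torsion_eigen (hpk : (p : k) ≠ 0) (s : ℤ) :
    Finite {P : geomPoints E // (p : ℤ) • P = 0 ∧ σ • P = s • P} := by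
  haveI := finite_torsion E hpk
  exact Finite.of_injective (fun P : {P : geomPoints E // (p : ℤ) • P = 0 ∧ σ • P = s • P} ↦
    (⟨P.1, P.2.1⟩ : {P : geomPoints E // (p : ℤ) • P = 0})) fun P Q h ↦
    Subtype.ext (by simpa using congrArg (fun x ↦ x.1) h)

/-- **Both eigenlines of a non-scalar involution on `Ẽ[p] ≅ (ℤ/p)²` have exactly `p` elements**
(`p` odd): `Ẽ[p] = Ẽ[p]⁺ ⊕ Ẽ[p]⁻` (tree `KolyvaginChi.exists_eigen_add_eigen`), `#Ẽ[p] = p²`, and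
neither summand is everything. Gross 1991, (3.4) *"`Ẽ(F_λ)_p^± ≃ ℤ/pℤ`"*; McCallum 1991, §3
*"both a plus and a minus eigenspace"*. [cite: GrossLMS1991, §3 (3.4)] -/
theorem natCard_torsion_eigen (hp2 : p ≠ 2) (hpk : (p : k) ≠ 0)
    (hinv : ∀ P : geomPoints E, (p : ℤ) • P = 0 → σ • σ • P = P)
    (hns : ∀ s : ℤ, s = 1 ∨ s = -1 → ¬ ∀ P : geomPoints E, (p : ℤ) • P = 0 → σ • P = s • P)
    {s : ℤ} (hs : s = 1 ∨ s = -1) :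
    Nat.card {P : geomPoints E // (p : ℤ) • P = 0 ∧ σ • P = s • P} = p := by
  haveI := finite_torsion E hpk
  haveI := finite_torsion_eigen E hpk (σ := σ)
  set T := {P : geomPoints E // (p : ℤ) • P = 0} with hT
  set Tp := {P : geomPoints E // (p : ℤ) • P = 0 ∧ σ • P = (1 : ℤ) • P} with hTp
  set Tm := {P : geomPoints E // (p : ℤ) • P = 0 ∧ σ • P = (-1 : ℤ) • P} with hTm
  have hcop : IsCoprime (2 : ℤ) (p : ℤ) := by
    rw [Int.isCoprime_iff_gcd_eq_one]
    have h2 : ¬ (p : ℤ) ∣ 2 := by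
      intro h
      have : p ∣ 2 := by exact_mod_cast h
      exact hp2 ((Nat.prime_dvd_prime_iff_eq hp.out Nat.prime_two).mp this)
    have := Int.gcd_dvd_right 2 (p : ℤ)
    have h1 := (Nat.dvd_prime hp.out).mp (show Int.gcd 2 (p : ℤ) ∣ p by exact_mod_cast this)
    rcases h1 with h1 | h1
    · exact h1
    · exfalso; apply h2
      have := Int.gcd_dvd_left 2 (p : ℤ)
      rw [h1] at this
      exact this
  -- the sum map `Tp × Tm → T` is a bijection
  set f : Tp × Tm → T := fun uw ↦ ⟨uw.1.1 + uw.2.1, by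
    rw [smul_add, uw.1.2.1, uw.2.2.1, add_zero]⟩ with hf
  have hfinj : Function.Injective f := by
    rintro ⟨⟨u, hu⟩, ⟨w, hw⟩⟩ ⟨⟨u', hu'⟩, ⟨w', hw'⟩⟩ h
    have h' : u + w = u' + w' := congrArg Subtype.val h
    have hd : u - u' = w' - w := sub_eq_sub_iff_add_eq_add.mpr (by rw [h', add_comm])
    -- `d = u - u'` is fixed and anti-fixed, killed by `p` and by `2`
    have hd1 : σ • (u - u') = u - u' := by rw [smul_sub, hu.2, hu'.2, one_smul, one_smul]
    have hd2 : σ • (u - u') = -(u - u') := by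
      rw [hd, smul_sub, hw'.2, hw.2, neg_smul, neg_smul, one_smul, one_smul]; abel
    have h2d : (2 : ℤ) • (u - u') = 0 := by
      rw [two_zsmul]
      nth_rewrite 1 [← hd1]
      rw [hd2, neg_add_cancel]
    have hpd : (p : ℤ) • (u - u') = 0 := by rw [smul_sub, hu.1, hu'.1, sub_zero]
    have hd0 : u - u' = 0 := KolyvaginChi.eq_zero_of_zsmul_eq_zero_of_isCoprime hcop h2d hpd
    have hu0 : u = u' := sub_eq_zero.mp hd0
    have hw0 : w = w' := by
      rw [hu0] at h'
      exact add_left_cancel h'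
    subst hu0 hw0
    rfl
  have hfsurj : Function.Surjective f := by
    rintro ⟨y, hy⟩
    -- decompose inside the `Γ_k`-module `E[p]`
    have hmemA : ∀ x : geomPoints E,
        x ∈ AddSubgroup.torsionBy (geomPoints E) (p : ℤ) ↔ (p : ℤ) • x = 0 := fun x ↦ by
      rw [AddSubgroup.torsionBy, Submodule.mem_toAddSubgroup, Submodule.mem_torsionBy_iff]
    have hyA : y ∈ AddSubgroup.torsionBy (geomPoints E) (p : ℤ) := (hmemA y).mpr hy
    set φ : AddSubgroup.torsionBy (geomPoints E) (p : ℤ) →+ AddSubgroup.torsionBy (geomPoints E) (p : ℤ) :=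
      DistribSMul.toAddMonoidHom _ σ with hφ
    have hφ2 : ∀ c : AddSubgroup.torsionBy (geomPoints E) (p : ℤ), φ (φ c) = c := fun c ↦ by
      apply Subtype.ext
      change σ • σ • (c : geomPoints E) = c
      exact hinv _ ((hmemA _).mp c.2)
    have hy1 : ((p : ℤ) ^ 1) • (⟨y, hyA⟩ : AddSubgroup.torsionBy (geomPoints E) (p : ℤ)) = 0 :=
      Subtype.ext (by rw [pow_one]; exact hy)
    obtain ⟨u, w, huw, hu, hw, hpu, hpw⟩ := KolyvaginChi.exists_eigen_add_eigen hp.out hp2 φ hφ2 hy1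
    rw [pow_one] at hpu hpw
    refine ⟨⟨⟨u, congrArg Subtype.val hpu, ?_⟩, ⟨w, congrArg Subtype.val hpw, ?_⟩⟩,
      Subtype.ext ?_⟩
    · rw [one_smul]; exact congrArg Subtype.val hu
    · rw [neg_smul, one_smul]; exact congrArg Subtype.val hw
    · exact (congrArg Subtype.val huw).symm
  have hcard : Nat.card Tp * Nat.card Tm = p ^ 2 := by
    rw [← Nat.card_prod, Nat.card_congr (Equiv.ofBijective f ⟨hfinj, hfsurj⟩),
      natCard_torsion_eq_sq E hpk]
  -- neither eigenline is all of `E[p]`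
  have hne : ∀ s : ℤ, s = 1 ∨ s = -1 →
      Nat.card {P : geomPoints E // (p : ℤ) • P = 0 ∧ σ • P = s • P} ≠ p ^ 2 := by
    intro s hs' h
    apply hns s hs'
    intro P hP
    have hsub : Function.Injective (fun Q : {P : geomPoints E // (p : ℤ) • P = 0 ∧ σ • P = s • P} ↦
        (⟨Q.1, Q.2.1⟩ : T)) := fun P Q h ↦ Subtype.ext (by simpa using congrArg (fun x ↦ x.1) h)
    have hbij := (Function.Injective.bijective_of_nat_card_le hsub
      (by rw [h, natCard_torsion_eq_sq E hpk])).2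
    obtain ⟨Q, hQ⟩ := hbij ⟨P, hP⟩
    have : (Q : geomPoints E) = P := congrArg Subtype.val hQ
    rw [← this]
    exact Q.2.2
  -- divisors of `p²`
  have hdvd : Nat.card Tp ∣ p ^ 2 := Dvd.intro _ hcard
  obtain ⟨i, hi, hTpi⟩ := (Nat.dvd_prime_pow hp.out).mp hdvd
  have hTm : Nat.card Tm = p ^ (2 - i) := by
    have h := hcard
    rw [hTpi, show p ^ 2 = p ^ i * p ^ (2 - i) by rw [← pow_add]; congr 1; omega] at h
    exact Nat.eq_of_mul_eq_mul_left (pow_pos hp.out.pos i) h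
  interval_cases i
  · exfalso; exact hne (-1) (Or.inr rfl) hTm
  · rcases hs with rfl | rfl
    · rw [hTpi, pow_one]
    · rw [hTm, pow_one]
  · exfalso; exact hne 1 (Or.inl rfl) hTpi

end Eigenlines


end Summit.BirchSwinnertonDyer.Rank1Residual.X11b.KolyvaginH44

end
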